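import Literature.MathematicalPhysics.QuantumFieldTheory.Balaban1983to89.B6SectADeltaACoerciveReductionV1
import Literature.MathematicalPhysics.QuantumFieldTheory.Balaban1983to89.B6Lemma24Torus

/-!
# `Balaban1983to89.B6SectALemma24OneLevelV1` — T. Bałaban, *Propagators and renormalization transformations for lattice gauge theories. II*,
# Commun. Math. Phys. **96** (1984) 223–250 [Balaban1984PropagatorsII], **Lemma 2.4 (2.128) p. 245 ON THE V1 TORUS CALCULUS AT ONE LEVEL**: the periodic lift
# of a bond configuration of the fine torus `T^{(0)}` of `Setup` to `ℤ^d` carries pv09's TORUS LEMMA 2.4 (`B6Lemma24Torus.lemma24_torus`, block side `Lᵏ`,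
# periods `2L^{m+K}`) over to the V1 carriers: `(1∕(12d²))·(Lᵏ)^{−(d+1)}·‖B‖² ≤ (Lᵏ)^{d−2}·Σ_{b̄∈T^{(k)}} |(Q_kB)(b̄)|² + Σ_p |(∂B)(p)|²` for every `B`
# whose staircase sums vanish on every block of order `k` — the Lemma-2.4 letter of `B6SectADeltaACoerciveReductionV1` for the ONE-LEVEL family
# `Domains.whole k`

statement-level skeleton of published theorems with citation tags; proofs where landed; nothing here is a claim about the Yang–Mills mass gap

PDF held: `paper:balaban1984-cmp96-propagators-rt-ii` (journal page = PDF page + 222), pp. 244–245, 249 (through the verbatim quotations of `B6Lemma24Torus`).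

CITATION HEADER (lean-in-tree rule).  Cell `pub-ymgap` (Track A, HUMAN RULING D-0062), node N10 [B13] lane owner `pub-ymgap-dag-n10-c` (g17), ROAD «C» station C4
(bus INBOX 2026-08-28T15:23Z ∕ 15:56Z; C1 = `B6SectADeltaACoerciveReductionV1` p645907, C2 = `B6SectATreeGaugeDecompositionV1`, C3 = `B6SectAPoincare211V1`),
filed `--supports stmt-QuantumFields-27364` (count-neutral helper).  WHY: after C2 (axial-gauge decomposition) and C3 ((2.11)) the ONLY displayed letter of C1's
`deltaAE_coercive_of_treeGauge_letters` is the Lemma-2.4-shaped bound `κ‖B‖² ≤ ‖∂B‖² + Σ_𝔅 w(QB)²` on the tree-gauged class.  THIS FILE proves it for the ONE-LEVEL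
nested family `D = Domains.whole k` (all of `T^{(0)}` at level `k`: the small-field-everywhere member; [B6] p. 239 «otherwise the operator G_□ is simply equal to
the operator G_j on the torus … thoroughly investigated in [4]») by TRANSPORT OF STRUCTURE from pv09's kernel theorem: the fine torus `Site P 0 = (Fin d → ZMod(2L^{m+K}))`
is read as `ℤ^d` modulo the periods `M_i = 2L^{m+K}`, blocks of side `Lᵏ` (`Lᵏ ∣ M_i`), and the three terms of (2.128) and the tree condition (2.121) are identified
with the V1 objects — `‖B‖²`, `Σ_p (curl 1 B p)²` (`LatticeFieldCalculus.curl`), `Σ_{b̄} (bondAvgIter k B b̄)²` via p39's one-stroke formula (1.18)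
(`bondAvgIter_eq_blockSum`), and the staircase sums `stairSum` of p38 (the trees MATCH: b06's `contour`∕`treeBonds` and `stairSum` both change the coordinates
`d, d−1, …, 1` from the block's corner).  IMPORTS C1 (hence the V1 model) and `B6Lemma24Torus` (pv09); nothing restated.

THE PRINT (verbatim, p. 245): *«Lemma 2.4. Let a set Λ ⊂ Z^d be a sum of blocks, Λ = B(Λ′). We denote by Λ also a set of bonds b such that at least one of the
end-points b₋, b₊ belongs to Λ. Let B be a configuration defined on Λ and satisfying the condition (2.121): B(Γ_{y,x}) = 0 for x ∈ B(y), y ∈ Λ′. We put B = 0 outside Λ.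
Then the following inequality holds L^{d−2} Σ_{c∈Λ′} |(Q₁B)(c)|² + Σ_p |(∂₁B)(p)|² ≥ (1∕(12d²)) L^{−d−1} ‖B‖². (2.128)»*; p. 249: *«on the whole lattice T^{(k)}»*.

WHAT IS DEFINED (bodies displayed; definition lane) AND PROVED (sorry-free; standard axioms).
* `castZ` (`ℤ^d → T^{(0)}`, coordinates mod `2L^{m+K}`), `toZ` (labels, its right inverse on the period box), `liftB B` (the `M`-periodic lift of a bond configuration
  to b06's carrier `Cfg d`), `cornerV1 k ȳ` (the corner site of `Bᵏ(ȳ)`, labels `ȳ_μ·Lᵏ`).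
* §1–§2 transport lemmas: `castZ_toZ`, `toZ_castZ_of_mem_pbox`, `castZ_add_period`, `castZ_add_unitVec` (`= shift`), `castZ_add_smul_unitVec` (`= runSite`),
  `isPeriodic_liftB`, `sum_pbox_eq_sum_site`, `toZ_cornerV1`, `cornerV1_mem_iterBlock`, `castZ_mem_iterBlock_of_mem_block`, `toZ_mem_block_of_mem_iterBlock`,
  `sum_block_eq_sum_iterBlock`, `sum_coarseSites_eq_sum_site`, `exists_eq_toZ_cornerV1`.
* §3 the three terms: ★ `normSqT_liftB` (`= ‖B‖²`), ★ `d1SqT_liftB` (`= Σ_{p : Plaq P 0} (curl 1 B p)²`), ★ `q1_liftB` (`(Q₁B^ℤ)(c) = bondAvgIter k B b̄`), ★ `q1SqT_liftB`.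
* §4 the tree condition: ★ `stairSum_shift_eq_add` (the staircase to `x + e_μ` is the staircase to `x` plus the bond `⟨x, x+e_μ⟩` when `x` agrees with the corner below
  `μ` and stays in the block), ★ `liftB_eq_zero_of_treeBond` ((2.121) bond-wise from the staircase sums).
* §5 ★★★ `lemma24_oneLevel_V1`: `1∕(12d²)·((Lᵏ)^{d+1})⁻¹·‖B‖² ≤ (Lᵏ)^{d−2}·Σ_{b̄ : PBond P k} (bondAvgIter k B b̄)² + Σ_{p : Plaq P 0} (curl 1 B p)²` for every `B` with
  vanishing staircase sums on every `Bᵏ(ȳ)` (`d ≥ 2`, `k ≤ m + K`); ★★★ `lemma24_letter_whole`: the `hL24` letter of C1 for `D = Domains.whole k`: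
  `κ·‖B‖² ≤ ‖dcE c B‖² + Σ_i w_i (QE D B)_i²` on the tree-gauged class of C2 (base points `cornerV1`), `κ = (1∕(12d²))·((Lᵏ)^{d+1})⁻¹·min(c², w₀∕(Lᵏ)^{d−2})`,
  a specialisation of ★★★ `lemma24_letter_oneLevel` — the same for ANY one-level nested family (`Ω_j = T_η`, `j ≤ k`; def-Y's `domT` at the top torus member is one)
  (`lamBond_oneLevel`, `lamSite_oneLevel`, `whole_oneLevel`, `bondIdxOneLevel`, `sum_weight_QE_oneLevel_ge`, `normSq_dcE_eq`, `lemma24_letter_const_pos`).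
HONEST SCOPE.  Transport of structure + bookkeeping; the one estimate is pv09's kernel theorem (Lemma 2.4 with the printed constant); ONE LEVEL only (the multi-level
`𝔅` with interfaces is print's Sect. C and is NOT claimed); NOT a node discharge; count-neutral; nothing continuum ∕ OS ∕ mass gap ∕ Clay.
-/

open scoped InnerProductSpace

namespace Literature.MathematicalPhysics.QuantumFieldTheory.Balaban1983to89.B6SectALemma24OneLevelV1

open LatticeFieldCalculus B5Eq118OneStroke B5Eq120IterProof B6SectADomainsV1 B6SectAOperatorsV1
open BalabanImbrieJaffe1984to88.BIJ85AxialPropagator411 (BondSpace)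
open B6Lemma24Torus (IsPeriodic pbox mem_pbox coarseSites mem_coarseSites faces mem_faces bondsT plaqT mem_plaqT normSqT d1SqT q1SqT lemma24_torus)
open B6BondElimination (treeBonds mem_treeBonds add_smul_unitVec_apply unitVec_apply)
open B6SectADeltaACoerciveReductionV1 (normSq_eq_sum_sq sum_bond_eq_sum_site_dir)

noncomputable section

variable {P : Params}

/-! ## §0. The period, the casts, the lift, the corners -/

/-- the fine torus `T^{(0)}` read as `ℤ^d` modulo its period `2L^{m+K}`: the cast of integer coordinates. [cite: Balaban1987RG1, (0.1) p.251] -/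
def castZ (z : Fin P.d → ℤ) : Site P 0 := fun i => ((z i : ℤ) : ZMod (P.sitesPerDir 0))

/-- the labels of a torus site (the representative in the period box `[0, 2L^{m+K})^d`). [cite: Balaban1987RG1, (0.1) p.251] -/
def toZ (x : Site P 0) : Fin P.d → ℤ := fun i => ((x i).val : ℤ)

/-- **the periodic lift** `B^ℤ(⟨z, z + e_μ⟩) := B(⟨z mod M, μ⟩)` of a bond configuration of `T^{(0)}` to b06's carrier `Cfg d`.
[cite: Balaban1984PropagatorsII, (2.152) p.249 («on the whole lattice T^{(k)}»)] -/
def liftB (B : BondSpace P) : B6TreeGaugePoincare.Cfg P.d := fun b => WithLp.ofLp B ⟨castZ b.1, b.2⟩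

/-- the CORNER of the block `Bᵏ(yk)` of order `k`: the fine site with labels `yk_μ·Lᵏ` (B5 (1.6)∕(1.7): the base point `y` of the contours `Γ_{y,x}`).
[cite: Balaban1984PropagatorsI, (1.6)–(1.7) p.18] -/
def cornerV1 (k : ℕ) (y : Site P k) : Site P 0 := fun i => ((((y i).val * P.L ^ k : ℕ) : ℤ) : ZMod (P.sitesPerDir 0))

/-- the periods of `T^{(0)}`: `M_i = 2L^{m+K}` in every direction. [cite: Balaban1987RG1, (0.1) p.251] -/
abbrev periodV1 (P : Params) : Fin P.d → ℕ := fun _ => P.sitesPerDir 0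

/-! ## §1. Transport lemmas: casts, periods, shifts, sums over the period box -/

/-- `castZ ∘ toZ = id`. [cite: Balaban1987RG1, (0.1) p.251; folklore] -/
theorem castZ_toZ (x : Site P 0) : castZ (toZ x) = x := by
  funext i; simp [castZ, toZ]

/-- `toZ ∘ castZ = id` on the period box. [cite: Balaban1987RG1, (0.1) p.251; folklore] -/
theorem toZ_castZ_of_mem_pbox {z : Fin P.d → ℤ} (hz : z ∈ pbox (periodV1 P)) : toZ (castZ z) = z := by
  funext i
  obtain ⟨h0, h1⟩ := mem_pbox.1 hz i
  simp only [toZ, castZ]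
  rw [ZMod.val_intCast, Int.emod_eq_of_lt h0 h1]

/-- `toZ x` lies in the period box. [cite: Balaban1987RG1, (0.1) p.251; folklore] -/
theorem toZ_mem_pbox (x : Site P 0) : toZ x ∈ pbox (periodV1 P) :=
  mem_pbox.2 fun i => ⟨Int.natCast_nonneg _, Int.ofNat_lt.mpr (ZMod.val_lt (x i))⟩

/-- the cast forgets periods. [cite: Balaban1987RG1, (0.1) p.251; folklore] -/
theorem castZ_add_period {z v : Fin P.d → ℤ} (hv : B6Lemma24Torus.IsPeriod (periodV1 P) v) : castZ (z + v) = castZ (P := P) z := by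
  funext i
  simp only [castZ, Pi.add_apply, Int.cast_add]
  rw [(ZMod.intCast_zmod_eq_zero_iff_dvd (v i) _).2 (hv i), add_zero]

/-- `castZ (z + e_μ) = (castZ z) + e_μ`. [cite: Balaban1984PropagatorsI, (1.4) p.18; folklore] -/
theorem castZ_add_unitVec (z : Fin P.d → ℤ) (μ : Fin P.d) : castZ (P := P) (z + B6BondElimination.unitVec μ) = (castZ z).shift μ := by
  funext i
  by_cases h : i = μ
  · subst h; simp [castZ, Site.shift, unitVec_apply]
  · simp [castZ, Site.shift, unitVec_apply, h]

/-- `castZ (z + t·e_μ) = runSite (castZ z) μ t` (the `t`-th site of the straight contour). [cite: Balaban1984PropagatorsI, (1.7) p.18; folklore] -/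
theorem castZ_add_smul_unitVec (z : Fin P.d → ℤ) (μ : Fin P.d) (t : ℕ) :
    castZ (P := P) (z + (t : ℤ) • B6BondElimination.unitVec μ) = runSite (castZ z) μ t := by
  funext i
  by_cases h : i = μ
  · subst h; simp [castZ, runSite, unitVec_apply]
  · simp [castZ, runSite, unitVec_apply, h]

/-- the lift is `M`-periodic: `B^ℤ` is a configuration on the torus in pv09's sense. [cite: Balaban1984PropagatorsII, (2.152) p.249] -/
theorem isPeriodic_liftB (B : BondSpace P) : IsPeriodic (periodV1 P) (liftB B) := by
  intro z v ν hv
  simp only [liftB, castZ_add_period hv]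

/-- sums over the period box are sums over the torus sites. [cite: Balaban1987RG1, (0.1) p.251; folklore] -/
theorem sum_pbox_eq_sum_site (f : (Fin P.d → ℤ) → ℝ) : ∑ z ∈ pbox (periodV1 P), f z = ∑ x : Site P 0, f (toZ x) := by
  refine Finset.sum_bij' (fun z _ => castZ z) (fun x _ => toZ x) (fun _ _ => Finset.mem_univ _) (fun x _ => toZ_mem_pbox x)
    (fun z hz => toZ_castZ_of_mem_pbox hz) (fun x _ => castZ_toZ x) (fun z hz => ?_)
  rw [toZ_castZ_of_mem_pbox hz]

/-! ## §2. Blocks of order `k` and coarse sites: `ℤ^d` ↔ `T^{(0)}`, `T^{(k)}` -/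

section Blocks

variable {k : ℕ} (hk : k ≤ P.m + P.K)

/-- `sitesPerDir 0 = sitesPerDir k · Lᵏ` (standing range). [cite: Balaban1987RG1, (0.1) p.251; folklore] -/
theorem sitesPerDir_zero_eq_mul (hk : k ≤ P.m + P.K) : P.sitesPerDir 0 = P.sitesPerDir k * P.L ^ k := by
  unfold Params.sitesPerDir
  rw [Nat.sub_zero, mul_assoc, ← pow_add, Nat.sub_add_cancel hk]

/-- the labels of a corner: `(cornerV1 k yk)_μ = yk_μ·Lᵏ` (no wrap-around). [cite: Balaban1984PropagatorsI, (1.6) p.18] -/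
theorem toZ_cornerV1 (hk : k ≤ P.m + P.K) (y : Site P k) (i : Fin P.d) : toZ (cornerV1 k y) i = ((y i).val * P.L ^ k : ℕ) := by
  simp only [toZ, cornerV1, Int.cast_natCast, ZMod.val_natCast]
  rw [Nat.mod_eq_of_lt]
  rw [sitesPerDir_zero_eq_mul hk]
  exact Nat.mul_lt_mul_of_lt_of_le (ZMod.val_lt (y i)) le_rfl (pow_pos P.L_pos k)

/-- `cornerV1 k yk = castZ (labels)`. [cite: Balaban1984PropagatorsI, (1.6) p.18] -/
theorem cornerV1_eq_castZ (y : Site P k) : cornerV1 k y = castZ (fun i => (((y i).val * P.L ^ k : ℕ) : ℤ)) := rfl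

/-- the corner lies in its block: `cornerV1 k ȳ ∈ Bᵏ(ȳ)` (an admissible base point for C2's decomposition). [cite: Balaban1984PropagatorsI, (1.6)–(1.7) p.18] -/
theorem cornerV1_mem_iterBlock (hk : k ≤ P.m + P.K) (y : Site P k) : cornerV1 k y ∈ iterBlock k y := by
  rw [mem_iterBlock_iff hk]
  intro μ
  have h := toZ_cornerV1 hk y μ
  simp only [toZ, Nat.cast_inj] at h
  rw [h, Nat.mul_div_cancel _ (pow_pos P.L_pos k)]

/-- a point of b06's block `B(y)` (corner `y = labels·Lᵏ`) casts into the V1 block `Bᵏ(yk)`. [cite: Balaban1984PropagatorsI, (1.6) p.18, (1.18) p.20] -/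
theorem castZ_mem_iterBlock_of_mem_block (hk : k ≤ P.m + P.K) (y : Site P k) {z : Fin P.d → ℤ}
    (hz : z ∈ B6Elimination.block (P.L ^ k) (toZ (cornerV1 k y))) : castZ z ∈ iterBlock k y := by
  rw [mem_iterBlock_iff hk]
  intro μ
  obtain ⟨h0, h1⟩ := B6Elimination.mem_block.1 hz μ
  rw [toZ_cornerV1 hk] at h0 h1
  have hz0 : 0 ≤ z μ := le_trans (by positivity) h0
  have hLk : (0 : ℤ) < (P.L : ℤ) ^ k := pow_pos (by exact_mod_cast P.L_pos) k
  have hlo : ((y μ).val : ℤ) * (P.L : ℤ) ^ k ≤ z μ := by exact_mod_cast h0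
  have hhi : z μ < ((y μ).val : ℤ) * (P.L : ℤ) ^ k + (P.L : ℤ) ^ k := by exact_mod_cast h1
  -- `z μ < sitesPerDir 0`
  have hlt : z μ < (P.sitesPerDir 0 : ℤ) := by
    have hy : (y μ).val + 1 ≤ P.sitesPerDir k := ZMod.val_lt (y μ)
    have h2 : (((y μ).val + 1 : ℕ) : ℤ) * (P.L : ℤ) ^ k ≤ (P.sitesPerDir 0 : ℤ) := by
      rw [sitesPerDir_zero_eq_mul hk]; exact_mod_cast Nat.mul_le_mul_right (P.L ^ k) hy
    push_cast at h2
    linarith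
  have hval : (((castZ (P := P) z) μ).val : ℤ) = z μ := by
    show ((((z μ : ℤ) : ZMod (P.sitesPerDir 0))).val : ℤ) = z μ
    rw [ZMod.val_intCast, Int.emod_eq_of_lt hz0 hlt]
  have hq : z μ / (P.L : ℤ) ^ k = (y μ).val :=
    le_antisymm (Int.lt_add_one_iff.mp ((Int.ediv_lt_iff_lt_mul hLk).mpr (by linarith)))
      ((Int.le_ediv_iff_mul_le hLk).mpr (by linarith))
  have : (((castZ (P := P) z μ).val / P.L ^ k : ℕ) : ℤ) = ((y μ).val : ℤ) := by
    rw [Int.natCast_div, hval]; push_cast; exact hq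
  exact_mod_cast this

/-- `toZ` maps the V1 block `Bᵏ(yk)` into b06's block over the corner's labels. [cite: Balaban1984PropagatorsI, (1.6) p.18] -/
theorem toZ_mem_block_of_mem_iterBlock (hk : k ≤ P.m + P.K) (y : Site P k) {x : Site P 0} (hx : x ∈ iterBlock k y) :
    toZ x ∈ B6Elimination.block (P.L ^ k) (toZ (cornerV1 k y)) := by
  rw [mem_iterBlock_iff hk] at hx
  refine B6Elimination.mem_block.2 fun μ => ?_
  rw [toZ_cornerV1 hk]
  have h := hx μ
  have hdiv := Nat.div_add_mod (x μ).val (P.L ^ k)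
  have hmod := Nat.mod_lt (x μ).val (pow_pos P.L_pos k)
  simp only [toZ]
  constructor
  · exact_mod_cast (show (y μ).val * P.L ^ k ≤ (x μ).val by rw [← h]; exact Nat.div_mul_le_self _ _)
  · have : (x μ).val < (y μ).val * P.L ^ k + P.L ^ k := by
      rw [← h]
      calc (x μ).val = P.L ^ k * ((x μ).val / P.L ^ k) + (x μ).val % P.L ^ k := hdiv.symm
        _ < P.L ^ k * ((x μ).val / P.L ^ k) + P.L ^ k := by omega
        _ = (x μ).val / P.L ^ k * P.L ^ k + P.L ^ k := by ring
    exact_mod_cast this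

/-- a point of b06's block over a corner lies in the period box. [cite: Balaban1987RG1, (0.1) p.251; folklore] -/
theorem mem_pbox_of_mem_block (hk : k ≤ P.m + P.K) (y : Site P k) {z : Fin P.d → ℤ}
    (hz : z ∈ B6Elimination.block (P.L ^ k) (toZ (cornerV1 k y))) : z ∈ pbox (periodV1 P) := by
  have hx := castZ_mem_iterBlock_of_mem_block hk y hz
  have hx' := toZ_mem_block_of_mem_iterBlock hk y hx
  -- both `z` and `toZ (castZ z)` lie in the same block and are congruent: compare labels
  refine mem_pbox.2 fun μ => ?_
  obtain ⟨h0, h1⟩ := B6Elimination.mem_block.1 hz μ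
  rw [toZ_cornerV1 hk] at h0 h1
  have hz0 : 0 ≤ z μ := le_trans (by positivity) h0
  refine ⟨hz0, ?_⟩
  have hy : (y μ).val + 1 ≤ P.sitesPerDir k := ZMod.val_lt (y μ)
  have := Nat.mul_le_mul_right (P.L ^ k) hy
  have h1' : z μ < (((y μ).val * P.L ^ k : ℕ) : ℤ) + (P.L ^ k : ℕ) := by exact_mod_cast h1
  show z μ < ((P.sitesPerDir 0 : ℕ) : ℤ)
  rw [sitesPerDir_zero_eq_mul hk]
  push_cast at h1' this ⊢
  nlinarith

/-- sums over b06's block over a corner are sums over the V1 block of order `k`. [cite: Balaban1984PropagatorsI, (1.18) p.20] -/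
theorem sum_block_eq_sum_iterBlock (hk : k ≤ P.m + P.K) (y : Site P k) (f : (Fin P.d → ℤ) → ℝ) :
    ∑ z ∈ B6Elimination.block (P.L ^ k) (toZ (cornerV1 k y)), f z = ∑ x ∈ iterBlock k y, f (toZ x) := by
  refine Finset.sum_bij' (fun z _ => castZ z) (fun x _ => toZ x) (fun z hz => castZ_mem_iterBlock_of_mem_block hk y hz)
    (fun x hx => toZ_mem_block_of_mem_iterBlock hk y hx) (fun z hz => toZ_castZ_of_mem_pbox (mem_pbox_of_mem_block hk y hz))
    (fun x _ => castZ_toZ x) (fun z hz => ?_)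
  rw [toZ_castZ_of_mem_pbox (mem_pbox_of_mem_block hk y hz)]

/-- the coarse sites `T′` of pv09's torus (multiples of `Lᵏ` in the period box) are the labels of the corners of `T^{(k)}`: sums transfer.
[cite: Balaban1984PropagatorsII, (2.128) p.245 (c ∈ Λ′); folklore] -/
theorem sum_coarseSites_eq_sum_site (hk : k ≤ P.m + P.K) (f : (Fin P.d → ℤ) → ℝ) :
    ∑ y ∈ coarseSites (P.L ^ k) (periodV1 P), f y = ∑ y : Site P k, f (toZ (cornerV1 k y)) := by
  classical
  -- inverse: `y ↦ (labels / Lᵏ)`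
  let inv : (Fin P.d → ℤ) → Site P k := fun y i => (((y i / (P.L : ℤ) ^ k).toNat : ℕ) : ZMod (P.sitesPerDir k))
  have hLk : (0 : ℤ) < (P.L : ℤ) ^ k := pow_pos (by exact_mod_cast P.L_pos) k
  -- `corner (inv y) = y` for a coarse site `y`
  have hright : ∀ y ∈ coarseSites (P.L ^ k) (periodV1 P), toZ (cornerV1 k (inv y)) = y := by
    intro y hy
    obtain ⟨hyb, hyd⟩ := mem_coarseSites.1 hy
    funext i
    obtain ⟨h0, h1⟩ := mem_pbox.1 hyb i
    obtain ⟨q, hq⟩ := hyd i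
    push_cast at hq
    have hq0 : 0 ≤ q := by nlinarith
    have hqlt : q < P.sitesPerDir k := by
      have h1' : y i < (P.sitesPerDir k : ℤ) * (P.L : ℤ) ^ k := by
        have : ((periodV1 P i : ℕ) : ℤ) = (P.sitesPerDir k : ℤ) * (P.L : ℤ) ^ k := by
          show ((P.sitesPerDir 0 : ℕ) : ℤ) = _
          rw [sitesPerDir_zero_eq_mul hk]; push_cast; ring
        rw [← this]; exact h1
      rw [hq] at h1'
      nlinarith
    rw [toZ_cornerV1 hk]
    have hv : (inv y i).val = q.toNat := by
      simp only [inv]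
      rw [hq, Int.mul_ediv_cancel_left _ hLk.ne', ZMod.val_natCast, Nat.mod_eq_of_lt (by omega)]
    rw [hv]; push_cast; rw [Int.toNat_of_nonneg hq0, hq]; ring
  refine Finset.sum_bij' (fun y _ => inv y) (fun y _ => toZ (cornerV1 k y)) (fun _ _ => Finset.mem_univ _) (fun y _ => ?_) (fun y hy => hright y hy)
    (fun y _ => ?_) (fun y hy => by rw [hright y hy])
  · -- corners are coarse sites
    refine mem_coarseSites.2 ⟨toZ_mem_pbox _, fun i => ?_⟩
    rw [toZ_cornerV1 hk]; push_cast; exact Dvd.intro_left _ rfl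
  · -- `inv (corner y) = y`
    funext i
    simp only [inv]
    rw [toZ_cornerV1 hk]
    push_cast
    rw [Int.mul_ediv_cancel _ hLk.ne', Int.toNat_natCast, ZMod.natCast_zmod_val]

end Blocks

/-! ## §3. The three terms of (2.128) for the lift: `‖B‖²`, `Σ_p (∂B)(p)²`, `Σ_c (Q₁B)(c)²` read on the V1 carriers -/

section Terms

variable {k : ℕ}

/-- `‖B^ℤ‖²_T = ‖B‖²`. [cite: Balaban1984PropagatorsII, (2.128) p.245, (2.153) p.249] -/
theorem normSqT_liftB (B : BondSpace P) : normSqT (periodV1 P) (liftB B) = ‖B‖ ^ 2 := by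
  rw [normSqT, B6Lemma24Torus.bondsT, Finset.sum_product, sum_pbox_eq_sum_site, normSq_eq_sum_sq, sum_bond_eq_sum_site_dir]
  refine Finset.sum_congr rfl fun x _ => Finset.sum_congr rfl fun μ _ => ?_
  simp only [liftB, castZ_toZ]

/-- `Σ_{p⊂T} (∂₁B^ℤ)(p)² = Σ_{p : Plaq P 0} (curl 1 B p)²` (b06's `curl` and `LatticeFieldCalculus.curl` are the same circulation). [cite: Balaban1984PropagatorsI, (1.4) p.18; Balaban1984PropagatorsII, (2.128) p.245] -/
theorem d1SqT_liftB (B : BondSpace P) :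
    d1SqT (periodV1 P) (liftB B) = ∑ p : Plaq P 0, LatticeFieldCalculus.curl 1 (WithLp.ofLp B) p ^ 2 := by
  rw [d1SqT]
  refine Finset.sum_bij' (fun q hq => (⟨castZ q.1, q.2.1, q.2.2, (mem_plaqT.1 hq).2⟩ : Plaq P 0)) (fun p _ => (toZ p.src, p.μ, p.ν))
    (fun _ _ => Finset.mem_univ _) (fun p _ => mem_plaqT.2 ⟨toZ_mem_pbox _, p.hμν⟩) (fun q hq => ?_) (fun p _ => ?_) (fun q hq => ?_)
  · obtain ⟨z, j, μ⟩ := q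
    simp only [toZ_castZ_of_mem_pbox (mem_plaqT.1 hq).1]
  · obtain ⟨x, j, μ, h⟩ := p
    simp only [castZ_toZ]
  · simp only [B6TreeGaugePoincare.curl, LatticeFieldCalculus.curl, liftB, castZ_add_unitVec, one_smul]

/-- the straight-contour sums agree: `Σ_{s<n} B^ℤ(x + s e_μ, μ) = segSum B (castZ x) μ n`. [cite: Balaban1984PropagatorsI, (1.8) p.19, (1.18) p.20] -/
theorem segSum_liftB (B : BondSpace P) (z : Fin P.d → ℤ) (μ : Fin P.d) (n : ℕ) :
    B6Lemma24PrintedShape.segSum n (liftB B) z μ = segSum (WithLp.ofLp B) (castZ z) μ n := by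
  simp only [B6Lemma24PrintedShape.segSum, segSum, runBond, liftB, castZ_add_smul_unitVec]

/-- ★ **`(Q₁B^ℤ)(c) = (Q_kB)(b̄)`**: pv09's verbatim (2.125) average at the coarse bond over the corner of `Bᵏ(yk)` is p39's `k`-fold average `bondAvgIter k B ⟨yk, μ⟩`
(one-stroke formula (1.18)). [cite: Balaban1984PropagatorsII, (2.125) p.245; Balaban1984PropagatorsI, (1.18) p.20] -/
theorem q1_liftB (hk : k ≤ P.m + P.K) (B : BondSpace P) (y : Site P k) (μ : Fin P.d) :
    B6Lemma24PrintedShape.q1 (P.L ^ k) (liftB B) (toZ (cornerV1 k y), μ) = bondAvgIter k (WithLp.ofLp B) ⟨y, μ⟩ := by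
  rw [B6Lemma24PrintedShape.q1, bondAvgIter_eq_blockSum k hk, smul_eq_mul, Finset.mul_sum]
  rw [sum_block_eq_sum_iterBlock hk y (fun z => (((P.L ^ k : ℕ) : ℝ) ^ (P.d + 1))⁻¹ * B6Lemma24PrintedShape.segSum (P.L ^ k) (liftB B) z μ)]
  refine Finset.sum_congr rfl fun x _ => ?_
  rw [segSum_liftB, castZ_toZ]
  congr 1
  push_cast
  rw [← pow_mul, ← pow_mul, mul_comm]

/-- ★ `Σ_{c∈T′} (Q₁B^ℤ)(c)² = Σ_{b̄ : PBond P k} (Q_kB)(b̄)²`. [cite: Balaban1984PropagatorsII, (2.128) p.245; Balaban1984PropagatorsI, (1.18) p.20] -/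
theorem q1SqT_liftB (hk : k ≤ P.m + P.K) (B : BondSpace P) :
    q1SqT (P.L ^ k) (periodV1 P) (liftB B) = ∑ b : PBond P k, bondAvgIter k (WithLp.ofLp B) b ^ 2 := by
  rw [q1SqT, B6Lemma24Torus.faces, Finset.sum_product, sum_coarseSites_eq_sum_site hk, sum_bond_eq_sum_site_dir]
  refine Finset.sum_congr rfl fun y _ => Finset.sum_congr rfl fun μ _ => ?_
  rw [q1_liftB hk]

end Terms

/-! ## §4. The tree condition (2.121): bond-wise vanishing on b06's trees from the vanishing of p38's staircase sums -/

section Tree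

variable {k : ℕ}

/-- ★ **one more bond on the staircase**: if `x` agrees with the base point `c` in the coordinates below `μ` and the `μ`-displacement `x_μ − c_μ` is a label
`t` with `t + 1 ≤ N∕2`, then `A(Γ_{c, x+e_μ}) = A(Γ_{c,x}) + A(⟨x, x + e_μ⟩)` (the staircase of (1.7) changes the coordinates `d, d−1, …, 1`, so the run in direction `μ`
is the last nonempty one and is prolonged by one bond). [cite: Balaban1984PropagatorsI, (1.7)–(1.8) pp.18–19] -/
theorem stairSum_shift_eq_add {V : Type*} [AddCommGroup V] [Module ℝ V] (A : VecField P 0 V) (c x : Site P 0) (μ : Fin P.d)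
    (hpre : ∀ ν, ν < μ → x ν = c ν) {t : ℕ} (ht : (x μ - c μ).valMinAbs = t) (ht1 : t + 1 ≤ P.sitesPerDir 0 / 2) :
    stairSum A c (x.shift μ) = stairSum A c x + A ⟨x, μ⟩ := by
  classical
  -- the displacement in direction `μ` as a residue
  have hxc : x μ - c μ = ((t : ℕ) : ZMod (P.sitesPerDir 0)) := by
    rw [← ZMod.coe_valMinAbs (x μ - c μ), ht, Int.cast_natCast]
  have hsh : (x.shift μ) μ - c μ = ((t + 1 : ℕ) : ZMod (P.sitesPerDir 0)) := by
    simp only [Site.shift, Function.update_self]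
    rw [add_sub_right_comm, hxc]; push_cast; ring
  have hval' : ((x.shift μ) μ - c μ).valMinAbs = ((t + 1 : ℕ) : ℤ) := by
    rw [hsh, ZMod.valMinAbs_natCast_of_le_half ht1]
  -- termwise comparison of the two staircase sums
  have hterm : ∀ ν : Fin P.d, runSum A (mixSite ν c (x.shift μ)) ν (((x.shift μ) ν - c ν).valMinAbs)
      = runSum A (mixSite ν c x) ν ((x ν - c ν).valMinAbs) + if ν = μ then A ⟨x, μ⟩ else 0 := by
    intro ν
    rcases lt_trichotomy ν μ with hlt | rfl | hgt
    · -- `ν < μ`: both runs are empty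
      have h1 : (x.shift μ) ν = c ν := by
        simp only [Site.shift, Function.update_of_ne (ne_of_lt hlt)]; exact hpre ν hlt
      have h2 : x ν = c ν := hpre ν hlt
      rw [h1, h2, sub_self, ZMod.valMinAbs_zero, runSum_zero, runSum_zero, if_neg (ne_of_lt hlt), add_zero]
    · -- `ν = μ`: the same run, one bond longer
      have hstart : mixSite ν c (x.shift ν) = mixSite ν c x := by
        funext ρ
        by_cases h : ν < ρ
        · simp only [mixSite, if_pos h, Site.shift, Function.update_of_ne (ne_of_gt h)]
        · simp only [mixSite, if_neg h]
      rw [hstart, hval', ht, if_pos rfl]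
      -- the added bond is `⟨x, x + e_ν⟩`: the run from the corner point reaches `x` after `t` steps
      have hrun : runSite (mixSite ν c x) ν t = x := by
        funext ρ
        by_cases h : ρ = ν
        · subst h
          simp only [runSite, Function.update_self, mixSite, lt_irrefl, if_false]
          have := hxc
          rw [sub_eq_iff_eq_add] at this
          rw [this]; ring
        · simp only [runSite, Function.update_of_ne h, mixSite]
          by_cases h2 : ρ < ν
          · have h3 : ¬ ν < ρ := not_lt.mpr h2.le
            rw [if_neg h3]; exact (hpre ρ h2).symm
          · have h3 : ν < ρ := lt_of_le_of_ne (not_lt.mp h2) (Ne.symm h)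
            rw [if_pos h3]
      rw [runSum_ofNat, runSum_ofNat, segSum, segSum, Finset.sum_range_succ, runBond, hrun]
    · -- `ν > μ`: identical runs
      have hstart : mixSite ν c (x.shift μ) = mixSite ν c x := by
        funext ρ
        by_cases h : ν < ρ
        · have hρ : ρ ≠ μ := ne_of_gt (lt_trans hgt h)
          simp only [mixSite, if_pos h, Site.shift, Function.update_of_ne hρ]
        · simp only [mixSite, if_neg h]
      have hlen : (x.shift μ) ν = x ν := by simp only [Site.shift, Function.update_of_ne (ne_of_gt hgt)]
      rw [hstart, hlen, if_neg (ne_of_gt hgt), add_zero]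
  simp only [stairSum, hterm, Finset.sum_add_distrib, Finset.sum_ite_eq', Finset.mem_univ, if_true]

/-- `Lᵏ ≤ N∕2`: a block of order `k` is at most half the fine torus (`N = 2L^{m+K}`). [cite: Balaban1987RG1, (0.1) p.251; folklore] -/
theorem pow_le_half_sitesPerDir (hk : k ≤ P.m + P.K) : P.L ^ k ≤ P.sitesPerDir 0 / 2 := by
  unfold Params.sitesPerDir
  rw [Nat.sub_zero, Nat.mul_div_cancel_left _ (by norm_num : 0 < 2)]
  exact Nat.pow_le_pow_right P.L_pos hk

/-- every coarse site of pv09's torus is the label vector of a corner of `T^{(k)}`. [cite: Balaban1984PropagatorsII, Lemma 2.4 p.245 (y ∈ Λ′); folklore] -/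
theorem exists_eq_toZ_cornerV1 (hk : k ≤ P.m + P.K) {y : Fin P.d → ℤ} (hy : y ∈ coarseSites (P.L ^ k) (periodV1 P)) :
    ∃ yk : Site P k, toZ (cornerV1 k yk) = y := by
  have hLk : (0 : ℤ) < (P.L : ℤ) ^ k := pow_pos (by exact_mod_cast P.L_pos) k
  obtain ⟨hyb, hyd⟩ := mem_coarseSites.1 hy
  refine ⟨fun i => (((y i / (P.L : ℤ) ^ k).toNat : ℕ) : ZMod (P.sitesPerDir k)), funext fun i => ?_⟩
  obtain ⟨h0, h1⟩ := mem_pbox.1 hyb i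
  obtain ⟨q, hq⟩ := hyd i
  push_cast at hq
  have hq0 : 0 ≤ q := by nlinarith
  have hqlt : q < P.sitesPerDir k := by
    have h1' : y i < (P.sitesPerDir k : ℤ) * (P.L : ℤ) ^ k := by
      have : ((periodV1 P i : ℕ) : ℤ) = (P.sitesPerDir k : ℤ) * (P.L : ℤ) ^ k := by
        show ((P.sitesPerDir 0 : ℕ) : ℤ) = _
        rw [sitesPerDir_zero_eq_mul hk]; push_cast; ring
      rw [← this]; exact h1
    rw [hq] at h1'
    nlinarith
  rw [toZ_cornerV1 hk]
  have hv : ((((y i / (P.L : ℤ) ^ k).toNat : ℕ) : ZMod (P.sitesPerDir k))).val = q.toNat := by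
    rw [hq, Int.mul_ediv_cancel_left _ hLk.ne', ZMod.val_natCast, Nat.mod_eq_of_lt (by omega)]
  rw [hv]; push_cast; rw [Int.toNat_of_nonneg hq0, hq]; ring

/-- ★ **(2.121) bond-wise for the lift**: if the staircase sums of `B` from the corner vanish on every block of order `k`, then `B^ℤ` vanishes on every bond of b06's
tree `Γ_y` of every coarse site `y` of the torus (`B(⟨w, w+e_μ⟩) = B(Γ_{y,w+e_μ}) − B(Γ_{y,w})`). [cite: Balaban1984PropagatorsII, (2.121) p.244; Balaban1984PropagatorsI, (1.7) p.18] -/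
theorem liftB_eq_zero_of_treeBond (hk : k ≤ P.m + P.K) (B : BondSpace P)
    (hT : ∀ (yk : Site P k), ∀ x ∈ iterBlock k yk, stairSum (WithLp.ofLp B) (cornerV1 k yk) x = 0) :
    ∀ y ∈ coarseSites (P.L ^ k) (periodV1 P), ∀ b ∈ treeBonds (P.L ^ k) y, liftB B b = 0 := by
  intro y hy b hb
  obtain ⟨yk, rfl⟩ := exists_eq_toZ_cornerV1 hk hy
  obtain ⟨hw, hpre, hlast⟩ := mem_treeBonds.1 hb
  -- the two end points of `b` lie in `Bᵏ(yk)`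
  have hx : castZ b.1 ∈ iterBlock k yk := castZ_mem_iterBlock_of_mem_block hk yk hw
  have hw' : b.1 + B6BondElimination.unitVec b.2 ∈ B6Elimination.block (P.L ^ k) (toZ (cornerV1 k yk)) := by
    refine B6Elimination.mem_block.2 fun i => ?_
    obtain ⟨h0, h1⟩ := B6Elimination.mem_block.1 hw i
    rw [show b.1 + B6BondElimination.unitVec b.2 = b.1 + (1 : ℤ) • B6BondElimination.unitVec b.2 by rw [one_smul], add_smul_unitVec_apply]
    by_cases h : i = b.2
    · subst h; rw [if_pos rfl]; constructor <;> omega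
    · rw [if_neg h]; constructor <;> omega
  have hx' : (castZ b.1).shift b.2 ∈ iterBlock k yk := by rw [← castZ_add_unitVec]; exact castZ_mem_iterBlock_of_mem_block hk yk hw'
  -- the displacement label `t = w_μ − y_μ`
  obtain ⟨h0, h1⟩ := B6Elimination.mem_block.1 hw b.2
  set t : ℕ := (b.1 b.2 - toZ (cornerV1 k yk) b.2).toNat with htdef
  have ht0 : (t : ℤ) = b.1 b.2 - toZ (cornerV1 k yk) b.2 := Int.toNat_of_nonneg (by omega)
  have htn : t + 1 + 1 ≤ P.L ^ k := by zify; rw [ht0]; push_cast at hlast ⊢; omega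
  have ht1 : t + 1 ≤ P.sitesPerDir 0 / 2 := le_trans (by omega) (pow_le_half_sitesPerDir hk)
  have hcμ : (castZ (P := P) b.1) b.2 - cornerV1 k yk b.2 = ((t : ℕ) : ZMod (P.sitesPerDir 0)) := by
    have hc : cornerV1 k yk b.2 = castZ (toZ (cornerV1 k yk)) b.2 := by rw [castZ_toZ]
    rw [hc]
    simp only [castZ]
    rw [← Int.cast_sub, ← ht0, Int.cast_natCast]
  have ht : ((castZ (P := P) b.1) b.2 - cornerV1 k yk b.2).valMinAbs = t := by
    rw [hcμ, ZMod.valMinAbs_natCast_of_le_half (le_trans (Nat.le_succ t) ht1)]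
  have hpre' : ∀ ν, ν < b.2 → (castZ (P := P) b.1) ν = cornerV1 k yk ν := by
    intro ν hν
    have hc : cornerV1 k yk ν = castZ (toZ (cornerV1 k yk)) ν := by rw [castZ_toZ]
    rw [hc]; simp only [castZ, hpre ν hν]
  have hstep := stairSum_shift_eq_add (WithLp.ofLp B) (cornerV1 k yk) (castZ b.1) b.2 hpre' ht ht1
  rw [hT yk _ hx, hT yk _ hx', zero_add] at hstep
  show WithLp.ofLp B ⟨castZ b.1, b.2⟩ = 0
  exact hstep.symm

end Tree

/-! ## §5. ★★★ Lemma 2.4 at one level on the V1 carriers; the Lemma-2.4 letter of C1 for `Domains.whole k` -/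

section Main

variable {k : ℕ}

/-- ★★★ **LEMMA 2.4 (2.128) ON THE FINE TORUS `T^{(0)}` OF `Setup`, BLOCKS OF ORDER `k`** (pv09's `lemma24_torus` carried over the periodic lift): for `d ≥ 2`,
`k ≤ m + K` and every bond configuration `B` whose staircase sums from the corner vanish on every block `Bᵏ(ȳ)` ((2.121)),
`(1∕(12d²))·((Lᵏ)^{d+1})⁻¹·‖B‖² ≤ (Lᵏ)^{d−2}·Σ_{b̄∈T^{(k)}} |(Q_kB)(b̄)|² + Σ_{p⊂T^{(0)}} |(∂B)(p)|²`.
[cite: Balaban1984PropagatorsII, Lemma 2.4 (2.128) p.245, (2.121) p.244, (2.153) p.249; Balaban1984PropagatorsI, (1.18) p.20] -/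
theorem lemma24_oneLevel_V1 (hd : 2 ≤ P.d) (hk : k ≤ P.m + P.K) (B : BondSpace P)
    (hT : ∀ (y : Site P k), ∀ x ∈ iterBlock k y, stairSum (WithLp.ofLp B) (cornerV1 k y) x = 0) :
    1 / (12 * (P.d : ℝ) ^ 2) * (((P.L : ℝ) ^ k) ^ (P.d + 1))⁻¹ * ‖B‖ ^ 2 ≤
      ((P.L : ℝ) ^ k) ^ (P.d - 2) * ∑ b : PBond P k, bondAvgIter k (WithLp.ofLp B) b ^ 2 +
        ∑ p : Plaq P 0, LatticeFieldCalculus.curl 1 (WithLp.ofLp B) p ^ 2 := by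
  have hn : 1 ≤ P.L ^ k := Nat.one_le_pow _ _ P.L_pos
  have hM : ∀ i : Fin P.d, 0 < periodV1 P i := fun _ => Nat.pos_of_ne_zero (P.sitesPerDir_ne_zero 0)
  have hLM : ∀ i : Fin P.d, P.L ^ k ∣ periodV1 P i := fun _ => by
    show P.L ^ k ∣ P.sitesPerDir 0
    rw [sitesPerDir_zero_eq_mul hk]; exact Dvd.intro_left _ rfl
  have h := lemma24_torus hd hn hM hLM (liftB B) (isPeriodic_liftB B) (liftB_eq_zero_of_treeBond hk B hT)
  rw [normSqT_liftB, q1SqT_liftB hk, d1SqT_liftB] at h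
  have hLr : (0 : ℝ) ≤ ((P.L ^ k : ℕ) : ℝ) := Nat.cast_nonneg _
  have e1 : ((P.L ^ k : ℕ) : ℝ) ^ (-((P.d : ℝ) + 1)) = (((P.L : ℝ) ^ k) ^ (P.d + 1))⁻¹ := by
    rw [Real.rpow_neg hLr, ← Nat.cast_succ, Real.rpow_natCast]; push_cast; rfl
  have e2 : ((P.L ^ k : ℕ) : ℝ) ^ ((P.d : ℝ) - 2) = ((P.L : ℝ) ^ k) ^ (P.d - 2) := by
    have h2 : ((P.d - 2 : ℕ) : ℝ) = (P.d : ℝ) - 2 := by rw [Nat.cast_sub hd]; norm_num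
    rw [← h2, Real.rpow_natCast]; push_cast; rfl
  rw [e1, e2] at h
  exact h

/-- **one-level nested families**: `Ω₀ = … = Ω_k = T_η` (p. 224: «we admit the case when some domains Ω_j are equal to T_η»; `Domains.whole k` and def-Y's `domT` at the
top torus member are instances) — then `Λ_k = T^{(k)}` and every bond of `T^{(k)}` belongs to `𝔅`. [cite: Balaban1984PropagatorsII, (2.1)–(2.3) p.224] -/
theorem lamBond_oneLevel (D : Domains P) (hD : ∀ j, j ≤ D.k → D.Om j = Finset.univ) (b : PBond P D.k) : D.LamBond D.k b := by
  rw [D.lamBond_top_iff]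
  exact Or.inl (by rw [hD D.k le_rfl]; exact Finset.mem_univ _)

/-- … and every site of `T^{(k)}` belongs to `Λ_k`. [cite: Balaban1984PropagatorsII, (2.1)–(2.3) p.224] -/
theorem lamSite_oneLevel (D : Domains P) (hD : ∀ j, j ≤ D.k → D.Om j = Finset.univ) (y : Site P D.k) : D.LamSite D.k y := by
  rw [D.lamSite_top_iff, hD D.k le_rfl]; exact Finset.mem_univ _

/-- `Domains.whole k` is one-level. [cite: Balaban1984PropagatorsII, (2.1) p.224] -/
theorem whole_oneLevel (hk : k ≤ P.m + P.K) : ∀ j, j ≤ (Domains.whole k hk).k → (Domains.whole k hk).Om j = Finset.univ := by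
  intro j hj
  have hj' : j ≤ k := hj
  show (if j ≤ k then Finset.univ else ∅ : Finset (Site P j)) = Finset.univ
  rw [if_pos hj']

/-- `T^{(k)}`-bonds as indices of `𝔅` for a one-level family. [cite: Balaban1984PropagatorsII, (2.3) p.224, (2.20) p.226] -/
def bondIdxOneLevel (D : Domains P) (hD : ∀ j, j ≤ D.k → D.Om j = Finset.univ) (b : PBond P D.k) : BondIdx D :=
  ⟨⟨⟨D.k, Nat.lt_succ_self _⟩, b⟩, lamBond_oneLevel D hD b⟩

/-- the index map is injective. [cite: Balaban1984PropagatorsII, (2.3) p.224; folklore] -/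
theorem bondIdxOneLevel_injective (D : Domains P) (hD : ∀ j, j ≤ D.k → D.Om j = Finset.univ) : Function.Injective (bondIdxOneLevel D hD) := by
  intro b b' h
  have := congrArg (fun i : BondIdx D => i.1) h
  simp only [bondIdxOneLevel, Sigma.mk.inj_iff, heq_eq_eq, true_and] at this
  exact this

/-- `(Q B)` at the index of a `T^{(k)}`-bond is `Q_kB` there. [cite: Balaban1984PropagatorsII, (2.20) p.226] -/
theorem QE_bondIdxOneLevel (D : Domains P) (hD : ∀ j, j ≤ D.k → D.Om j = Finset.univ) (B : BondSpace P) (b : PBond P D.k) :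
    QE D B (bondIdxOneLevel D hD b) = bondAvgIter D.k (WithLp.ofLp B) b := rfl

/-- the weighted averaging term of `Δ_a` dominates `w₀·Σ_{b̄∈T^{(k)}} (Q_kB)(b̄)²` for a one-level family (weights `w ≥ w₀ ≥ 0`).
[cite: Balaban1984PropagatorsII, (2.18)–(2.20) p.226] -/
theorem sum_weight_QE_oneLevel_ge (D : Domains P) (hD : ∀ j, j ≤ D.k → D.Om j = Finset.univ) {w : BondIdx D → ℝ} {w₀ : ℝ} (hw₀ : 0 ≤ w₀)
    (hw : ∀ i, w₀ ≤ w i) (B : BondSpace P) :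
    w₀ * ∑ b : PBond P D.k, bondAvgIter D.k (WithLp.ofLp B) b ^ 2 ≤ ∑ i, w i * QE D B i ^ 2 := by
  classical
  calc w₀ * ∑ b : PBond P D.k, bondAvgIter D.k (WithLp.ofLp B) b ^ 2
      = ∑ b : PBond P D.k, w₀ * QE D B (bondIdxOneLevel D hD b) ^ 2 := by rw [Finset.mul_sum]; rfl
    _ ≤ ∑ b : PBond P D.k, w (bondIdxOneLevel D hD b) * QE D B (bondIdxOneLevel D hD b) ^ 2 :=
        Finset.sum_le_sum fun b _ => mul_le_mul_of_nonneg_right (hw _) (sq_nonneg _)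
    _ = ∑ i ∈ Finset.univ.map ⟨bondIdxOneLevel D hD, bondIdxOneLevel_injective D hD⟩, w i * QE D B i ^ 2 := by
        rw [Finset.sum_map]; rfl
    _ ≤ ∑ i, w i * QE D B i ^ 2 :=
        Finset.sum_le_sum_of_subset_of_nonneg (Finset.subset_univ _) fun i _ _ => mul_nonneg (hw₀.trans (hw i)) (sq_nonneg _)

/-- `‖∂_c B‖² = c²·Σ_p (curl 1 B p)²` (the plaquette variable scales with the lattice factor). [cite: Balaban1984PropagatorsI, (1.2)–(1.4) p.18] -/
theorem normSq_dcE_eq (c : ℝ) (B : BondSpace P) : ‖dcE c B‖ ^ 2 = c ^ 2 * ∑ p : Plaq P 0, LatticeFieldCalculus.curl 1 (WithLp.ofLp B) p ^ 2 := by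
  rw [normSq_eq_sum_sq, Finset.mul_sum]
  refine Finset.sum_congr rfl fun p _ => ?_
  rw [dcE_apply]
  simp only [LatticeFieldCalculus.curl, smul_eq_mul, one_mul]
  ring

/-- ★★★ **THE LEMMA-2.4 LETTER OF C1 FOR A ONE-LEVEL FAMILY** (`Ω₀ = … = Ω_k = T_η`, e.g. `Domains.whole k`): for `d ≥ 2`, lattice factor `c`, weights `w ≥ w₀ ≥ 0` on `𝔅`, and
every `B` in the tree-gauged class of C2 with base points `cornerV1` — `κ·‖B‖² ≤ ‖∂B‖² + Σ_𝔅 w(QB)²` with `κ = (1∕(12d²))·((Lᵏ)^{d+1})⁻¹·min(c², w₀∕(Lᵏ)^{d−2})`, `k = D.k` — the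
`hL24` hypothesis of `B6SectADeltaACoerciveReductionV1.deltaAE_coercive_of_treeGauge_letters` (only the level-`k` blocks occur).
[cite: Balaban1984PropagatorsII, Lemma 2.4 (2.128) p.245, (2.19) p.226, (2.121) p.244] -/
theorem lemma24_letter_oneLevel (hd : 2 ≤ P.d) (D : Domains P) (hD : ∀ j, j ≤ D.k → D.Om j = Finset.univ) (c : ℝ) {w : BondIdx D → ℝ} {w₀ : ℝ}
    (hw₀ : 0 ≤ w₀) (hw : ∀ i, w₀ ≤ w i) (B : BondSpace P)
    (hT : ∀ (j : ℕ) (y : Site P j), D.LamSite j y → ∀ x ∈ iterBlock j y, stairSum (WithLp.ofLp B) (cornerV1 j y) x = 0) :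
    1 / (12 * (P.d : ℝ) ^ 2) * (((P.L : ℝ) ^ D.k) ^ (P.d + 1))⁻¹ * min (c ^ 2) (w₀ / ((P.L : ℝ) ^ D.k) ^ (P.d - 2)) * ‖B‖ ^ 2 ≤
      ‖dcE c B‖ ^ 2 + ∑ i, w i * QE D B i ^ 2 := by
  -- the staircase sums vanish on every block of order `k` (`Λ_k = T^{(k)}`)
  have hT' : ∀ (y : Site P D.k), ∀ x ∈ iterBlock D.k y, stairSum (WithLp.ofLp B) (cornerV1 D.k y) x = 0 :=
    fun y x hx => hT D.k y (lamSite_oneLevel D hD y) x hx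
  have h24 := lemma24_oneLevel_V1 hd D.hk B hT'
  set α : ℝ := 1 / (12 * (P.d : ℝ) ^ 2) * (((P.L : ℝ) ^ D.k) ^ (P.d + 1))⁻¹ with hα
  set nq : ℝ := ((P.L : ℝ) ^ D.k) ^ (P.d - 2) with hnq
  set SQ : ℝ := ∑ b : PBond P D.k, bondAvgIter D.k (WithLp.ofLp B) b ^ 2 with hSQ
  set SC : ℝ := ∑ p : Plaq P 0, LatticeFieldCalculus.curl 1 (WithLp.ofLp B) p ^ 2 with hSC
  set μ : ℝ := min (c ^ 2) (w₀ / nq) with hμ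
  have hnq0 : 0 < nq := by rw [hnq]; exact pow_pos (pow_pos (by exact_mod_cast P.L_pos) _) _
  have hSQ0 : 0 ≤ SQ := Finset.sum_nonneg fun _ _ => sq_nonneg _
  have hSC0 : 0 ≤ SC := Finset.sum_nonneg fun _ _ => sq_nonneg _
  have hμ0 : 0 ≤ μ := le_min (sq_nonneg c) (div_nonneg hw₀ hnq0.le)
  -- `μ·(nq·SQ + SC) ≤ w₀·SQ + c²·SC`
  have h1 : μ * (nq * SQ) ≤ w₀ * SQ := by
    calc μ * (nq * SQ) ≤ (w₀ / nq) * (nq * SQ) := mul_le_mul_of_nonneg_right (min_le_right _ _) (mul_nonneg hnq0.le hSQ0)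
      _ = w₀ * SQ := by field_simp
  have h2 : μ * SC ≤ c ^ 2 * SC := mul_le_mul_of_nonneg_right (min_le_left _ _) hSC0
  have hQ := sum_weight_QE_oneLevel_ge D hD hw₀ hw B
  rw [normSq_dcE_eq]
  calc α * μ * ‖B‖ ^ 2 = μ * (α * ‖B‖ ^ 2) := by ring
    _ ≤ μ * (nq * SQ + SC) := mul_le_mul_of_nonneg_left h24 hμ0
    _ = μ * (nq * SQ) + μ * SC := by ring
    _ ≤ w₀ * SQ + c ^ 2 * SC := add_le_add h1 h2
    _ ≤ (∑ i, w i * QE D B i ^ 2) + c ^ 2 * SC := by linarith [hQ]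
    _ = c ^ 2 * SC + ∑ i, w i * QE D B i ^ 2 := by ring

/-- the constant of `lemma24_letter_oneLevel` is positive for `c ≠ 0`, `w₀ > 0`. [cite: Balaban1984PropagatorsII, Lemma 2.4 (2.128) p.245; folklore] -/
theorem lemma24_letter_const_pos (k : ℕ) {c w₀ : ℝ} (hc : c ≠ 0) (hw₀ : 0 < w₀) (hd : 1 ≤ P.d) :
    0 < 1 / (12 * (P.d : ℝ) ^ 2) * (((P.L : ℝ) ^ k) ^ (P.d + 1))⁻¹ * min (c ^ 2) (w₀ / ((P.L : ℝ) ^ k) ^ (P.d - 2)) := by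
  have hL : (0 : ℝ) < (P.L : ℝ) ^ k := pow_pos (by exact_mod_cast P.L_pos) _
  have hd' : (0 : ℝ) < (P.d : ℝ) := by exact_mod_cast hd
  have hmin : 0 < min (c ^ 2) (w₀ / ((P.L : ℝ) ^ k) ^ (P.d - 2)) := lt_min (by positivity) (div_pos hw₀ (pow_pos hL _))
  positivity

/-- ★★★ the same letter for `D = Domains.whole k` verbatim. [cite: Balaban1984PropagatorsII, Lemma 2.4 (2.128) p.245, (2.1) p.224] -/
theorem lemma24_letter_whole (hd : 2 ≤ P.d) (hk : k ≤ P.m + P.K) (c : ℝ) {w : BondIdx (Domains.whole k hk) → ℝ} {w₀ : ℝ} (hw₀ : 0 ≤ w₀)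
    (hw : ∀ i, w₀ ≤ w i) (B : BondSpace P)
    (hT : ∀ (j : ℕ) (y : Site P j), (Domains.whole k hk).LamSite j y → ∀ x ∈ iterBlock j y, stairSum (WithLp.ofLp B) (cornerV1 j y) x = 0) :
    1 / (12 * (P.d : ℝ) ^ 2) * (((P.L : ℝ) ^ k) ^ (P.d + 1))⁻¹ * min (c ^ 2) (w₀ / ((P.L : ℝ) ^ k) ^ (P.d - 2)) * ‖B‖ ^ 2 ≤
      ‖dcE c B‖ ^ 2 + ∑ i, w i * QE (Domains.whole k hk) B i ^ 2 :=
  lemma24_letter_oneLevel hd (Domains.whole k hk) (whole_oneLevel hk) c hw₀ hw B hT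

end Main

end

end Literature.MathematicalPhysics.QuantumFieldTheory.Balaban1983to89.B6SectALemma24OneLevelV1
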